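import Literature.LinearAlgebra.Matrix.CyclicBlockDeterminant
import HarnessLib

/-!
# The Wilson-type cyclic block matrix and its transfer-matrix determinant formula

For blocks `a_t, b_t, d_t, w_t ∈ M_τ(R)` (`t ∈ Fin (k+1)`, indices mod `k+1`) the block matrix
`wilsonBlock a b d w` on `(τ ⊕ τ) × Fin (k+1)` has diagonal blocks `[a_t, b_t; -b_tᴴ, d_t]`, the
block `-[0, 0; 0, w_t]` in position `(t, t+1)` and `-[w_sᴴ, 0; 0, 0]` in position `(s+1, s)`.
This is the time-slice form of the `r = 1` Wilson–Dirac operator of lattice QCD in a spin basis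
diagonalising `γ₀` (upper/lower components = `P_± = (1 ± γ₀)/2`, `w_t` = temporal link variables,
`a_t = d_t`, `b_t` = spatial hopping blocks). We prove Lüscher's transfer-matrix evaluation of its
determinant in purely finite-dimensional form:

* `det_wilsonBlock` — for invertible `a_t` and unitary `w_t`,
  `det W = (-1)^|τ| (∏ det a_t)(∏ det w_t) det (1 - Ŵ_kᴴ𝒴_k ⋯ Ŵ₀ᴴ𝒴₀)` with the transfer step
  `𝒴_t = transferStep a_t b_t d_t = [a⁻¹, -a⁻¹b; -bᴴa⁻¹, d + bᴴa⁻¹b]` and `Ŵ_t = diag(w_t, w_t)`;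
* `det_wilsonBlock_antiperiodic` — with the sign of the last temporal layer flipped
  (antiperiodic quarks) the formula becomes `(∏ det a_t)(∏ det w_t) det (1 + Ŵ_kᴴ𝒴_k ⋯ Ŵ₀ᴴ𝒴₀)`;
* `transferStep_eq_conj`, `isHermitian_transferStep`, `posDef_transferStep`, `det_transferStep` —
  `𝒴 = Eᴴ diag(a⁻¹, d) E` with `E = [1, -b; 0, 1]`, so `𝒴` is Hermitian positive definite as soon
  as `a, d` are (for Wilson fermions: hopping parameter `|κ| < 1/6`, Montvay–Münster (4.111)).

Proof: the column permutation `η` (`etaPerm`) makes `W` cyclic block-bidiagonal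
(`wilsonBlock_submatrix_etaPerm`); then `det_cyclicBidiag` and a telescoping of the temporal links
(`reverse_prod_ofFn_conj_mul`). Sources: M. Lüscher, Commun. Math. Phys. 54 (1977) 283; I. Montvay,
G. Münster, *Quantum Fields on a Lattice* (1994) §4.1.3, §4.2.3–4.2.4. All statements are proved.
Not here: the identification with the lattice operator `wilsonDirac` (done where it is used).
-/

noncomputable section

namespace Literature.LinearAlgebra.Matrix

open _root_.Matrix

section WilsonBlock

variable {τ : Type*} [Fintype τ] [DecidableEq τ] {R : Type*} [CommRing R] [StarRing R]

/-- **The Wilson-type cyclic block matrix.** On `(τ ⊕ τ) × Fin (k+1)` ("upper/lower spinor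
components × time slices") the block matrix with diagonal blocks
`A_t = [a_t, b_t; -b_tᴴ, d_t]`, the block `-[0, 0; 0, w_t]` in position `(t, t+1)` and the block
`-[w_sᴴ, 0; 0, 0]` in position `(s+1, s)` (indices mod `k+1`). This is the time-slice block form of
the `r = 1` Wilson–Dirac operator in a spin basis diagonalising `γ₀`
(Lüscher, Commun. Math. Phys. 54 (1977) 283, §3; Montvay–Münster (1994) §4.2.3). [folklore] -/
def wilsonBlock {k : ℕ} (a b d w : Fin (k + 1) → Matrix τ τ R) :
    Matrix ((τ ⊕ τ) × Fin (k + 1)) ((τ ⊕ τ) × Fin (k + 1)) R :=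
  Matrix.of fun p q =>
    (if p.2 = q.2 then Matrix.fromBlocks (a p.2) (b p.2) (-(b p.2)ᴴ) (d p.2) p.1 q.1 else 0) -
    (if q.2 = p.2 + 1 then Matrix.fromBlocks 0 0 0 (w p.2) p.1 q.1 else 0) -
    (if p.2 = q.2 + 1 then Matrix.fromBlocks (w q.2)ᴴ 0 0 0 p.1 q.1 else 0)

/-- The transfer step of one time slice: `𝒴_t = [a⁻¹, -a⁻¹b; -bᴴa⁻¹, d + bᴴa⁻¹b]`
(Hermitian and positive when `a, d` are; it factors as `Eᴴ diag(a⁻¹, d) E` with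
`E = [1, -b; 0, 1]`, `transferStep_eq_conj`). [folklore] -/
def transferStep (a b d : Matrix τ τ R) : Matrix (τ ⊕ τ) (τ ⊕ τ) R :=
  Matrix.fromBlocks a⁻¹ (-(a⁻¹ * b)) (-(bᴴ * a⁻¹)) (bᴴ * a⁻¹ * b + d)

/-- The doubled temporal link block `Ŵ = diag(w, w)` acting alike on both spinor halves. [folklore] -/
def linkBlock (w : Matrix τ τ R) : Matrix (τ ⊕ τ) (τ ⊕ τ) R :=
  Matrix.fromBlocks w 0 0 w

/-- The transfer step factors as `Eᴴ · diag(a⁻¹, d) · E` with the unipotent `E = [1, -b; 0, 1]`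
(no hypothesis on `a` is needed for this identity). [folklore] -/
theorem transferStep_eq_conj (a b d : Matrix τ τ R) :
    transferStep a b d = (Matrix.fromBlocks 1 (-b) 0 1)ᴴ * Matrix.fromBlocks a⁻¹ 0 0 d *
      Matrix.fromBlocks 1 (-b) 0 1 := by
  rw [Matrix.fromBlocks_conjTranspose, Matrix.fromBlocks_multiply, Matrix.fromBlocks_multiply,
    transferStep]
  simp [Matrix.mul_assoc, add_comm]

omit [Fintype τ] [DecidableEq τ] in
/-- Upper–upper block entries of `wilsonBlock`. [folklore] -/
@[simp] theorem wilsonBlock_apply_inl_inl {k : ℕ} (a b d w : Fin (k + 1) → Matrix τ τ R)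
    (i j : τ) (t s : Fin (k + 1)) :
    wilsonBlock a b d w (Sum.inl i, t) (Sum.inl j, s) =
      (if t = s then a t i j else 0) - (if t = s + 1 then (w s)ᴴ i j else 0) := by
  simp [wilsonBlock]

omit [Fintype τ] [DecidableEq τ] in
/-- Upper–lower block entries of `wilsonBlock`. [folklore] -/
@[simp] theorem wilsonBlock_apply_inl_inr {k : ℕ} (a b d w : Fin (k + 1) → Matrix τ τ R)
    (i j : τ) (t s : Fin (k + 1)) :
    wilsonBlock a b d w (Sum.inl i, t) (Sum.inr j, s) = if t = s then b t i j else 0 := by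
  simp [wilsonBlock]

omit [Fintype τ] [DecidableEq τ] in
/-- Lower–upper block entries of `wilsonBlock`. [folklore] -/
@[simp] theorem wilsonBlock_apply_inr_inl {k : ℕ} (a b d w : Fin (k + 1) → Matrix τ τ R)
    (i j : τ) (t s : Fin (k + 1)) :
    wilsonBlock a b d w (Sum.inr i, t) (Sum.inl j, s) = if t = s then -(b t)ᴴ i j else 0 := by
  simp [wilsonBlock]

omit [Fintype τ] [DecidableEq τ] in
/-- Lower–lower block entries of `wilsonBlock`. [folklore] -/
@[simp] theorem wilsonBlock_apply_inr_inr {k : ℕ} (a b d w : Fin (k + 1) → Matrix τ τ R)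
    (i j : τ) (t s : Fin (k + 1)) :
    wilsonBlock a b d w (Sum.inr i, t) (Sum.inr j, s) =
      (if t = s then d t i j else 0) - (if s = t + 1 then w t i j else 0) := by
  simp [wilsonBlock]

omit [Fintype τ] [DecidableEq τ] in
/-- A matrix with the four block-entry patterns of `wilsonBlock` is `wilsonBlock`. [folklore] -/
theorem eq_wilsonBlock {k : ℕ} (a b d w : Fin (k + 1) → Matrix τ τ R)
    (D : Matrix ((τ ⊕ τ) × Fin (k + 1)) ((τ ⊕ τ) × Fin (k + 1)) R)
    (h₁₁ : ∀ i j t s, D (Sum.inl i, t) (Sum.inl j, s) =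
      (if t = s then a t i j else 0) - (if t = s + 1 then (w s)ᴴ i j else 0))
    (h₁₂ : ∀ i j t s, D (Sum.inl i, t) (Sum.inr j, s) = if t = s then b t i j else 0)
    (h₂₁ : ∀ i j t s, D (Sum.inr i, t) (Sum.inl j, s) = if t = s then -(b t)ᴴ i j else 0)
    (h₂₂ : ∀ i j t s, D (Sum.inr i, t) (Sum.inr j, s) =
      (if t = s then d t i j else 0) - (if s = t + 1 then w t i j else 0)) :
    D = wilsonBlock a b d w := by
  ext ⟨x, t⟩ ⟨y, s⟩
  rcases x with i | i <;> rcases y with j | j <;> simp [h₁₁, h₁₂, h₂₁, h₂₂]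

/-- The column permutation `η` of the transfer-matrix evaluation: upper spinor components stay
in their slice, lower components are moved one slice forward (`(inr i, s) ↦ (inr i, s + 1)`). [folklore] -/
def etaPerm (τ : Type*) (k : ℕ) : Equiv.Perm ((τ ⊕ τ) × Fin (k + 1)) :=
  (Equiv.sumProdDistrib τ τ (Fin (k + 1))).symm.permCongr
    (Equiv.sumCongr (Equiv.refl _) (Equiv.prodCongrRight fun _ : τ => finRotate (k + 1)))

omit [Fintype τ] [DecidableEq τ] in
/-- `η` fixes the upper components. [folklore] -/
@[simp] theorem etaPerm_inl {k : ℕ} (i : τ) (s : Fin (k + 1)) :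
    etaPerm τ k (Sum.inl i, s) = (Sum.inl i, s) := by
  simp [etaPerm]

omit [Fintype τ] [DecidableEq τ] in
/-- `η` moves the lower components one slice forward. [folklore] -/
@[simp] theorem etaPerm_inr {k : ℕ} (i : τ) (s : Fin (k + 1)) :
    etaPerm τ k (Sum.inr i, s) = (Sum.inr i, s + 1) := by
  simp [etaPerm]

/-- The sign of `η`: `|τ|` disjoint `(k+1)`-cycles. [folklore] -/
theorem sign_etaPerm (k : ℕ) : Equiv.Perm.sign (etaPerm τ k) = (-1) ^ (k * Fintype.card τ) := by
  rw [etaPerm, Equiv.Perm.sign_permCongr, Equiv.Perm.sign_sumCongr, Equiv.Perm.sign_refl, one_mul,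
    Equiv.Perm.sign_prodCongrRight]
  simp only [sign_finRotate, Nat.add_sub_cancel, Finset.prod_const, Finset.card_univ]
  rw [← pow_mul]
  congr

omit [Fintype τ] [DecidableEq τ] in
/-- **The column permutation `η` turns the Wilson block matrix into a cyclic block-bidiagonal
matrix** with diagonal blocks `M_t = [a_t, 0; -b_tᴴ, -w_t]` and sub-diagonal blocks
`N_t = [-w_{t-1}ᴴ, b_t; 0, d_t]`. [folklore] -/
theorem wilsonBlock_submatrix_etaPerm {k : ℕ} (a b d w : Fin (k + 1) → Matrix τ τ R) :
    (wilsonBlock a b d w).submatrix id (etaPerm τ k) = Matrix.of fun p q =>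
      (if p.2 = q.2 then Matrix.fromBlocks (a p.2) 0 (-(b p.2)ᴴ) (-(w p.2)) p.1 q.1 else 0) +
      (if p.2 = q.2 + 1 then Matrix.fromBlocks (-(w (p.2 - 1))ᴴ) (b p.2) 0 (d p.2) p.1 q.1 else 0) := by
  ext ⟨x, t⟩ ⟨y, s⟩
  rcases x with i | i <;> rcases y with j | j
  · rw [Matrix.submatrix_apply, id, etaPerm_inl, wilsonBlock_apply_inl_inl, Matrix.of_apply]
    simp only [Matrix.fromBlocks_apply₁₁, sub_eq_add_neg]
    congr 1
    split_ifs with h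
    · subst h; simp
    · simp
  · rw [Matrix.submatrix_apply, id, etaPerm_inr, wilsonBlock_apply_inl_inr, Matrix.of_apply]
    simp only [Matrix.fromBlocks_apply₁₂, Matrix.zero_apply]
    split_ifs <;> simp
  · rw [Matrix.submatrix_apply, id, etaPerm_inl, wilsonBlock_apply_inr_inl, Matrix.of_apply]
    simp only [Matrix.fromBlocks_apply₂₁, Matrix.zero_apply]
    split_ifs <;> simp
  · rw [Matrix.submatrix_apply, id, etaPerm_inr, wilsonBlock_apply_inr_inr, Matrix.of_apply]
    simp only [Matrix.fromBlocks_apply₂₂, add_left_inj, sub_eq_add_neg, Matrix.neg_apply]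
    rw [add_comm]
    congr 1
    by_cases h : t = s
    · subst h; simp
    · simp [h, Ne.symm h]

/-- The explicit transfer block `X_t = M_t⁻¹ N_t` of the bidiagonal form. [folklore] -/
theorem transferBlock_mul {k : ℕ} (a b d w : Fin (k + 1) → Matrix τ τ R)
    (ha : ∀ t, IsUnit (a t).det) (hw : ∀ t, w t * (w t)ᴴ = 1) (t : Fin (k + 1)) :
    Matrix.fromBlocks (a t) 0 (-(b t)ᴴ) (-(w t)) *
      (Matrix.fromBlocks 1 0 0 (w t)ᴴ *
        Matrix.fromBlocks (-(a t)⁻¹) ((a t)⁻¹ * b t) ((b t)ᴴ * (a t)⁻¹) (-((b t)ᴴ * (a t)⁻¹ * b t + d t)) *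
        Matrix.fromBlocks (w (t - 1))ᴴ 0 0 1) =
      Matrix.fromBlocks (-(w (t - 1))ᴴ) (b t) 0 (d t) := by
  have h1 : ∀ X : Matrix τ τ R, a t * ((a t)⁻¹ * X) = X := fun X =>
    Matrix.mul_nonsing_inv_cancel_left _ _ (ha t)
  have h2 : ∀ X : Matrix τ τ R, w t * ((w t)ᴴ * X) = X := fun X => by
    rw [← Matrix.mul_assoc, hw t, Matrix.one_mul]
  simp only [Matrix.fromBlocks_multiply]
  congr 1 <;> simp [Matrix.mul_assoc, h1, h2, Matrix.mul_add]

/-- **Transfer-matrix formula for the determinant of the Wilson block matrix** (periodic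
temporal links). With `𝒴_t = transferStep a_t b_t d_t`, `Ŵ_t = linkBlock w_t`, invertible `a_t`
and unitary `w_t`:
`det (wilsonBlock a b d w) = (-1)^|τ| (∏ₜ det a_t) (∏ₜ det w_t) det (1 - Ŵ_kᴴ𝒴_k ⋯ Ŵ₀ᴴ𝒴₀)`.
This is Lüscher's transfer-matrix evaluation of the free-fermion Gaussian integral on a time
circle in first-quantised form (Lüscher 1977 §3; Montvay–Münster (1994) §4.2.3): the column
permutation `η` (`wilsonBlock_submatrix_etaPerm`), the cyclic bidiagonal determinant
(`det_cyclicBidiag`) and the telescoping of the temporal links (`reverse_prod_ofFn_conj_mul`). [folklore] -/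
theorem det_wilsonBlock {k : ℕ} (a b d w : Fin (k + 1) → Matrix τ τ R)
    (ha : ∀ t, IsUnit (a t).det) (hw : ∀ t, w t * (w t)ᴴ = 1) :
    (wilsonBlock a b d w).det = (-1) ^ Fintype.card τ * (∏ t, (a t).det) * (∏ t, (w t).det) *
      (1 - (List.ofFn fun t => (linkBlock (w t))ᴴ * transferStep (a t) (b t) (d t)).reverse.prod).det := by
  -- notation
  set Mb : Fin (k + 1) → Matrix (τ ⊕ τ) (τ ⊕ τ) R :=
    fun t => Matrix.fromBlocks (a t) 0 (-(b t)ᴴ) (-(w t)) with hMb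
  set Nb : Fin (k + 1) → Matrix (τ ⊕ τ) (τ ⊕ τ) R :=
    fun t => Matrix.fromBlocks (-(w (t - 1))ᴴ) (b t) 0 (d t) with hNb
  set Λ : Fin (k + 1) → Matrix (τ ⊕ τ) (τ ⊕ τ) R := fun t => Matrix.fromBlocks 1 0 0 (w t)ᴴ with hΛ
  set Λ' : Fin (k + 1) → Matrix (τ ⊕ τ) (τ ⊕ τ) R := fun t => Matrix.fromBlocks (w (t - 1))ᴴ 0 0 1 with hΛ'
  set Y : Fin (k + 1) → Matrix (τ ⊕ τ) (τ ⊕ τ) R := fun t =>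
    Matrix.fromBlocks (-(a t)⁻¹) ((a t)⁻¹ * b t) ((b t)ᴴ * (a t)⁻¹) (-((b t)ᴴ * (a t)⁻¹ * b t + d t)) with hY
  set V : Fin (k + 1) → Matrix (τ ⊕ τ) (τ ⊕ τ) R := fun t => (linkBlock (w (t - 1)))ᴴ with hV
  -- unitarity consequences
  have hw' : ∀ t, (w t)ᴴ * w t = 1 := fun t => mul_eq_one_comm.mp (hw t)
  have hwu : ∀ t, IsUnit (w t).det := fun t => Matrix.isUnit_det_of_right_inverse (hw t)
  have hMbdet : ∀ t, (Mb t).det = (a t).det * ((-1) ^ Fintype.card τ * (w t).det) := by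
    intro t; rw [hMb, Matrix.det_fromBlocks_zero₁₂, Matrix.det_neg]
  have hMbu : ∀ t, IsUnit (Mb t).det := fun t => by
    rw [hMbdet]
    exact (ha t).mul (((isUnit_one.neg).pow _).mul (hwu t))
  have hX : ∀ t, (Mb t)⁻¹ * Nb t = Λ t * Y t * Λ' t := by
    intro t
    have h := transferBlock_mul a b d w ha hw t
    simp only [hMb, hNb, hΛ, hΛ', hY]
    rw [← h, Matrix.nonsing_inv_mul_cancel_left _ _ (hMbu t)]
  -- step 1: the permutation and the bidiagonal determinant
  have hperm := Matrix.det_permute' (etaPerm τ k) (wilsonBlock a b d w)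
  rw [wilsonBlock_submatrix_etaPerm, det_cyclicBidiag Mb Nb hMbu, sign_etaPerm] at hperm
  have hsign : (wilsonBlock a b d w).det = (((-1 : ℤˣ) ^ (k * Fintype.card τ) : ℤˣ) : ℤ) *
      ((∏ t, (Mb t).det) * (1 + (-1 : R) ^ k • (List.ofFn fun t => (Mb t)⁻¹ * Nb t).reverse.prod).det) := by
    rw [hperm, ← mul_assoc, ← Int.cast_mul, ← Units.val_mul, ← sq, Int.units_sq]
    simp
  rw [hsign]
  simp only [hX]
  -- step 2: telescoping, twice, onto the common word `Q = ∏ (Y_t V_t)`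
  have hV0 : ((0 : Fin (k + 1)) - 1) = Fin.last k := by
    refine Fin.ext ?_
    rw [Fin.coe_sub_one, if_pos rfl, Fin.val_last]
  have hVsucc : ∀ t' : Fin k, (t'.succ - 1 : Fin (k + 1)) = t'.castSucc := fun t' => by
    refine Fin.ext ?_
    rw [Fin.coe_sub_one, if_neg (Fin.succ_ne_zero t'), Fin.val_succ, Fin.val_castSucc, Nat.add_sub_cancel]
  have hV : ∀ t, V t = Matrix.fromBlocks (w (t - 1))ᴴ 0 0 (w (t - 1))ᴴ := fun t => by
    simp [hV, linkBlock, Matrix.fromBlocks_conjTranspose]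
  have hcases1 : ∀ t, Λ' t * Fin.cases (motive := fun _ => Matrix (τ ⊕ τ) (τ ⊕ τ) R)
      (Λ (Fin.last k)) (fun t' => Λ t'.castSucc) t = V t := by
    intro t
    refine Fin.cases ?_ (fun t' => ?_) t
    · simp only [Fin.cases_zero, hΛ, hΛ', hV, Matrix.fromBlocks_multiply, hV0]
      simp
    · simp only [Fin.cases_succ, hΛ, hΛ', hV, Matrix.fromBlocks_multiply, hVsucc]
      simp
  have hlink : ∀ x : Matrix τ τ R, (linkBlock x)ᴴ = Matrix.fromBlocks xᴴ 0 0 xᴴ := fun x => by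
    simp [linkBlock, Matrix.fromBlocks_conjTranspose]
  have hcases2 : ∀ t, Fin.cases (motive := fun _ => Matrix (τ ⊕ τ) (τ ⊕ τ) R)
      ((linkBlock (w (Fin.last k)))ᴴ) (fun t' => (linkBlock (w t'.castSucc))ᴴ) t = V t := by
    intro t
    refine Fin.cases ?_ (fun t' => ?_) t
    · simp only [Fin.cases_zero, hV, hV0, hlink]
    · simp only [Fin.cases_succ, hV, hVsucc, hlink]
  set Q := (List.ofFn fun t => Y t * V t).reverse.prod with hQ
  have htel1 : (List.ofFn fun t => Λ t * Y t * Λ' t).reverse.prod * Λ (Fin.last k) = Λ (Fin.last k) * Q := by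
    rw [reverse_prod_ofFn_conj_mul Λ Y Λ' (Λ (Fin.last k)), hQ]
    simp only [Matrix.mul_assoc, hcases1]
  have htel2 : (List.ofFn fun t => (linkBlock (w t))ᴴ * Y t).reverse.prod * (linkBlock (w (Fin.last k)))ᴴ =
      (linkBlock (w (Fin.last k)))ᴴ * Q := by
    have h := reverse_prod_ofFn_conj_mul (fun t => (linkBlock (w t))ᴴ) Y (fun _ => 1) ((linkBlock (w (Fin.last k)))ᴴ)
    simp only [Matrix.mul_one] at h
    rw [h, hQ]
    simp only [hcases2]
  have hΛu : IsUnit (Λ (Fin.last k)).det := by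
    rw [hΛ]
    simp only [Matrix.det_fromBlocks_zero₁₂, Matrix.det_one, one_mul, Matrix.det_conjTranspose]
    exact (hwu _).star
  have hEu : IsUnit ((linkBlock (w (Fin.last k)))ᴴ).det := by
    rw [Matrix.det_conjTranspose, linkBlock, Matrix.det_fromBlocks_zero₁₂]
    exact ((hwu _).mul (hwu _)).star
  have hdetQ : (1 + (-1 : R) ^ k • (List.ofFn fun t => Λ t * Y t * Λ' t).reverse.prod).det =
      (1 + (-1 : R) ^ k • (List.ofFn fun t => (linkBlock (w t))ᴴ * Y t).reverse.prod).det := by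
    rw [det_one_add_smul_eq_of_mul_eq hΛu _ htel1, det_one_add_smul_eq_of_mul_eq hEu _ htel2]
  rw [hdetQ]
  -- step 3: `Y_t = -𝒴_t` and the signs
  have hYneg : ∀ t, Y t = -transferStep (a t) (b t) (d t) := fun t => by
    simp only [hY, transferStep, Matrix.fromBlocks_neg, neg_neg]
  have hneg : (List.ofFn fun t => (linkBlock (w t))ᴴ * Y t).reverse.prod =
      (-1 : R) ^ (k + 1) • (List.ofFn fun t => (linkBlock (w t))ᴴ * transferStep (a t) (b t) (d t)).reverse.prod := by
    rw [← reverse_prod_ofFn_neg]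
    simp only [hYneg, Matrix.mul_neg]
  rw [hneg, smul_smul, ← pow_add, show k + (k + 1) = 2 * k + 1 by ring, pow_succ, pow_mul, neg_one_sq,
    one_pow, one_mul, neg_one_smul, ← sub_eq_add_neg]
  -- the scalar prefactors
  have hprod : (∏ t, (Mb t).det) = (∏ t, (a t).det) * (((-1 : R) ^ Fintype.card τ) ^ (k + 1) * ∏ t, (w t).det) := by
    rw [Finset.prod_congr rfl fun t _ => hMbdet t, Finset.prod_mul_distrib, Finset.prod_mul_distrib,
      Finset.prod_const, Finset.card_univ, Fintype.card_fin]
  have hs : ((-1 : R)) ^ (k * Fintype.card τ) * ((-1 : R) ^ Fintype.card τ) ^ (k + 1) =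
      (-1) ^ Fintype.card τ := by
    rw [← pow_mul, ← pow_add, show k * Fintype.card τ + Fintype.card τ * (k + 1) =
      2 * (k * Fintype.card τ) + Fintype.card τ by ring, pow_add, pow_mul, neg_one_sq, one_pow, one_mul]
  rw [hprod]
  have hcast : ((((-1 : ℤˣ) ^ (k * Fintype.card τ) : ℤˣ) : ℤ) : R) = (-1 : R) ^ (k * Fintype.card τ) := by
    -- the power of `ℤˣ` by `ℕ` elaborates through `Int.instUnitsPow`; convert it to the monoid power
    have h : ((-1 : ℤˣ) ^ (k * Fintype.card τ) : ℤˣ) =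
        @HPow.hPow ℤˣ ℕ ℤˣ (@instHPow ℤˣ ℕ NPow.toPow) (-1 : ℤˣ) (k * Fintype.card τ) := rfl
    rw [h, Units.val_pow_eq_pow_val, Units.val_neg, Units.val_one, Int.cast_pow, Int.cast_neg, Int.cast_one]
  rw [hcast]
  linear_combination ((∏ t, (a t).det) * (∏ t, (w t).det) *
    (1 - (List.ofFn fun t => (linkBlock (w t))ᴴ * transferStep (a t) (b t) (d t)).reverse.prod).det) * hs

/-- **Transfer-matrix formula with antiperiodic temporal boundary condition**: flipping the sign
of the temporal links of the last layer turns `det (1 - 𝒫)` into `det (1 + 𝒫)` (the fermionic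
trace instead of the supertrace) and removes the sign `(-1)^|τ|`:
`det (wilsonBlock a b d w⁻) = (∏ₜ det a_t) (∏ₜ det w_t) det (1 + Ŵ_kᴴ𝒴_k ⋯ Ŵ₀ᴴ𝒴₀)`
(Montvay–Münster (1994) §4.1.3 (4.34), §4.2.4 (4.112)–(4.114)). [folklore] -/
theorem det_wilsonBlock_antiperiodic {k : ℕ} (a b d w : Fin (k + 1) → Matrix τ τ R)
    (ha : ∀ t, IsUnit (a t).det) (hw : ∀ t, w t * (w t)ᴴ = 1) :
    (wilsonBlock a b d (Function.update w (Fin.last k) (-w (Fin.last k)))).det =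
      (∏ t, (a t).det) * (∏ t, (w t).det) *
      (1 + (List.ofFn fun t => (linkBlock (w t))ᴴ * transferStep (a t) (b t) (d t)).reverse.prod).det := by
  set w' := Function.update w (Fin.last k) (-w (Fin.last k)) with hw'def
  have hw'c : ∀ i : Fin k, w' i.castSucc = w i.castSucc := fun i =>
    Function.update_of_ne (Fin.castSucc_ne_last i) _ _
  have hw'l : w' (Fin.last k) = -w (Fin.last k) := Function.update_self _ _ _
  have hw' : ∀ t, w' t * (w' t)ᴴ = 1 := by
    intro t
    by_cases ht : t = Fin.last k
    · subst ht; rw [hw'l, Matrix.conjTranspose_neg, neg_mul_neg, hw]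
    · rw [hw'def, Function.update_of_ne ht, hw]
  rw [det_wilsonBlock a b d w' ha hw']
  have hprod : (∏ t, (w' t).det) = (-1) ^ Fintype.card τ * ∏ t, (w t).det := by
    rw [Fin.prod_univ_castSucc, Fin.prod_univ_castSucc, hw'l, Matrix.det_neg]
    simp only [hw'c]
    ring
  have hP : (List.ofFn fun t => (linkBlock (w' t))ᴴ * transferStep (a t) (b t) (d t)).reverse.prod =
      -(List.ofFn fun t => (linkBlock (w t))ᴴ * transferStep (a t) (b t) (d t)).reverse.prod := by
    rw [reverse_prod_ofFn_succ', reverse_prod_ofFn_succ', hw'l]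
    simp only [hw'c]
    rw [show linkBlock (-w (Fin.last k)) = -linkBlock (w (Fin.last k)) by
      simp [linkBlock, Matrix.fromBlocks_neg], Matrix.conjTranspose_neg, Matrix.neg_mul, Matrix.neg_mul]
  rw [hprod, hP, sub_neg_eq_add]
  have hs : ((-1 : R) ^ Fintype.card τ) * (-1) ^ Fintype.card τ = 1 := by
    rw [← pow_add, ← two_mul, pow_mul, neg_one_sq, one_pow]
  linear_combination ((∏ t, (a t).det) * (∏ t, (w t).det) *
    (1 + (List.ofFn fun t => (linkBlock (w t))ᴴ * transferStep (a t) (b t) (d t)).reverse.prod).det) * hs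

/-- The transfer step is Hermitian when `a` and `d` are. [folklore] -/
theorem isHermitian_transferStep {a b d : Matrix τ τ R} (ha : a.IsHermitian) (hd : d.IsHermitian) :
    (transferStep a b d).IsHermitian := by
  rw [transferStep_eq_conj]
  exact Matrix.isHermitian_conjTranspose_mul_mul _ (Matrix.IsHermitian.fromBlocks ha.inv (by simp) hd)

/-- The determinant of the transfer step: `det 𝒴 = det a⁻¹ · det d`. [folklore] -/
theorem det_transferStep (a b d : Matrix τ τ R) :
    (transferStep a b d).det = a⁻¹.det * d.det := by
  rw [transferStep_eq_conj, Matrix.det_mul, Matrix.det_mul, Matrix.det_conjTranspose,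
    Matrix.det_fromBlocks_zero₂₁, Matrix.det_fromBlocks_zero₂₁]
  simp

end WilsonBlock

section Positivity

variable {τ : Type*} [Fintype τ] [DecidableEq τ] {𝕜 : Type*} [RCLike 𝕜]

open scoped ComplexOrder

omit [DecidableEq τ] in
/-- A block-diagonal matrix with positive definite diagonal blocks is positive definite. [folklore] -/
theorem posDef_fromBlocks_zero {a : Matrix τ τ 𝕜} {d : Matrix τ τ 𝕜} (ha : a.PosDef) (hd : d.PosDef) :
    (Matrix.fromBlocks a 0 0 d).PosDef := by
  rw [Matrix.posDef_iff_dotProduct_mulVec]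
  refine ⟨Matrix.IsHermitian.fromBlocks ha.isHermitian (by simp) hd.isHermitian, fun x hx => ?_⟩
  rw [← Sum.elim_comp_inl_inr x, Matrix.fromBlocks_mulVec]
  simp only [Matrix.zero_mulVec, add_zero, zero_add, Sum.elim_comp_inl, Sum.elim_comp_inr]
  rw [Function.star_sumElim, sumElim_dotProduct_sumElim]
  have h1 := (Matrix.posSemidef_iff_dotProduct_mulVec.mp ha.posSemidef).2 (x ∘ Sum.inl)
  have h2 := (Matrix.posSemidef_iff_dotProduct_mulVec.mp hd.posSemidef).2 (x ∘ Sum.inr)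
  by_cases h : x ∘ Sum.inl = 0
  · have h' : x ∘ Sum.inr ≠ 0 := by
      intro h'
      apply hx
      rw [← Sum.elim_comp_inl_inr x, h, h']
      ext (i | i) <;> rfl
    exact add_pos_of_nonneg_of_pos h1 ((Matrix.posDef_iff_dotProduct_mulVec.mp hd).2 h')
  · exact add_pos_of_pos_of_nonneg ((Matrix.posDef_iff_dotProduct_mulVec.mp ha).2 h) h2

/-- **The transfer step of a slice with positive definite spatial blocks is positive definite**
(`𝒴 = Eᴴ diag(a⁻¹, d) E` with `E` invertible). This is where the site-reflection-positivity
range of the hopping parameter enters: `a_t, d_t > 0` is `|κ| < 1/(2(d-1))` for `r = 1` Wilson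
fermions (Montvay–Münster (1994) §4.2.3, (4.111); Lüscher 1977). [folklore] -/
theorem posDef_transferStep {a b d : Matrix τ τ 𝕜} (ha : a.PosDef) (hd : d.PosDef) :
    (transferStep a b d).PosDef := by
  rw [transferStep_eq_conj, ← Matrix.star_eq_conjTranspose]
  have hE : IsUnit (Matrix.fromBlocks (1 : Matrix τ τ 𝕜) (-b) (0 : Matrix τ τ 𝕜) (1 : Matrix τ τ 𝕜)) := by
    rw [Matrix.isUnit_iff_isUnit_det, Matrix.det_fromBlocks_zero₂₁]
    simp
  exact (Matrix.IsUnit.posDef_star_left_conjugate_iff hE).2 (posDef_fromBlocks_zero ha.inv hd)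

end Positivity

end Literature.LinearAlgebra.Matrix

end
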